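import Mathlib.Algebra.Field.ZMod
import Mathlib.AlgebraicGeometry.EllipticCurve.Affine.Point
import Literature.Computability.Complexity.BoolEncodings
import HarnessLib

/-!
# The prime-field elliptic-curve discrete-logarithm language `EcdlpLanguage`

Trunk `Literature/Computability/Cryptography`; definition request `defn-EcdlpLanguage` (route
`PneNP/EcdlpDefinability`, items `EcdlpNotInP` = stmt-PneNP-2071 and `EcdlpInNP` = stmt-PneNP-2075).
The decision (bounded) form of the elliptic-curve discrete-logarithm problem over prime fields,
as a language over Cook's alphabet `{0,1}`, next to the finite-field notions `IsDLogInstance`,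
`encodeDLogInstance` (`Shor.lean`) and `DLOGHalf` (`DLogHalf.lean`):

* `EcdlpLanguage : Language Bool` — the binary encodings (`encodingListNatBool`, i.e.
  `encodingNatBool.listBool`) of the lists `[p, a₁, a₂, a₃, a₄, a₆, x_P, y_P, x_Q, y_Q, t]` of
  naturals such that `p` is prime, the Weierstrass curve `W = ⟨a₁, a₂, a₃, a₄, a₆⟩` over `ZMod p`
  (coefficients cast into `ZMod p`) has discriminant `Δ ≠ 0`, `P = (x_P, y_P)` and
  `Q = (x_Q, y_Q)` (cast into `ZMod p`) are nonsingular affine points of `W`, and `m • P = Q` for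
  some `m ≤ t` in Mathlib's group `WeierstrassCurve.Affine.Point` of `W`. The body is VERBATIM
  the inline term of the two route items, so that they restate as
  `EcdlpLanguage ∉ PNPWave0.P Bool` and `EcdlpLanguage ∈ PNPWave0.NP Bool` (both `Iff.rfl`,
  checked in the literature-prover's scratch file against the route file).
* `ecdlpCurve p a₁ a₂ a₃ a₄ a₆ : WeierstrassCurve (ZMod p)` — the curve of an instance;
  `EcdlpSolvable p a₁ a₂ a₃ a₄ a₆ xp yp xq yq t : Prop` — the membership condition on the
  11-tuple (a YES-instance); `ecdlpSet : Set (List ℕ)` — the set of such lists; and the API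
  `EcdlpLanguage_eq : EcdlpLanguage = encodingListNatBool.toLanguage ecdlpSet` (`rfl`),
  `mem_ecdlpSet_iff`, `encode_mem_EcdlpLanguage_iff`, `mem_EcdlpLanguage_iff`,
  `EcdlpSolvable.prime`, `EcdlpSolvable.isElliptic`, `EcdlpSolvable.mono`.

## Sources

* V. S. Miller, *Use of elliptic curves in cryptography*, CRYPTO '85, LNCS 218 (1986) 417–426,
  § "Key exchange, and discrete elliptic logarithms", pp. 421–423 (the discrete logarithm
  problem in the group `E(𝔽_p)` as the basis of key exchange; "index calculus" unlikely to work
  on elliptic curves). [Miller1986ECC]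
* J. H. Silverman, *The Arithmetic of Elliptic Curves*, 2nd ed., GTM 106 (2009), §XI.4,
  Definition (DLP in a group: `m` with `x^m = y`) and Example XI.4.1(c) (ECDLP: a solution `m`
  of `[m]P = Q` for given `P, Q ∈ E(𝔽_q)`); Remark V.1.6. [SilvermanAEC2009]
* S. Cook, *The P versus NP problem*, Clay Mathematics Institute (2006), §1 (decision problems
  as languages over a finite alphabet; the classes P and NP). [CookClay2006]

## Design choices

* Decision version with an explicit bound `t`: the instance `(p, W, P, Q, t)` is accepted iff
  `m • P = Q` for some `m ≤ t`. Binary search on `t` recovers the least logarithm with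
  `O(log t)` membership queries, so deciding `EcdlpLanguage` in polynomial time is equivalent to
  computing prime-field elliptic discrete logarithms in polynomial time (folklore
  search-to-decision; `EcdlpSolvable.mono` is the monotonicity in `t` this uses).
* General Weierstrass models (all five `aᵢ`), not short models, so `p = 2, 3` are covered
  uniformly; `Δ ≠ 0` over the field `ZMod p` is Mathlib's `W.IsElliptic`
  (`EcdlpSolvable.isElliptic`), hence `W.Point` is the group of an elliptic curve over `𝔽_p`.
* Inputs are naturals CAST into `ZMod p`, with no range check `aᵢ < p` (several lists encode
  the same instance — harmless for a language, and exactly the route's term).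
* `Q ∈ ⟨P⟩` is not a promise (Silverman's DLP hypothesis) but part of what is decided: if `Q`
  is not a multiple of `P`, the tuple is a NO-instance for every `t`. Likewise primality of `p`,
  `Δ ≠ 0` and nonsingularity of `P`, `Q` are membership conditions (all polynomial-time).
* `Fact p.Prime` is supplied INSIDE the term by `haveI … := ⟨hp⟩` under the existential
  `∃ hp : p.Prime`, exactly as in the route file: the group law on
  `WeierstrassCurve.Affine.Point` needs `Field (ZMod p)` (`Mathlib.Algebra.Field.ZMod`).
* Deliberately NOT here: any complexity statement (`EcdlpLanguage ∉ P`, `∈ NP` are the route's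
  items under `Summits/PneNP`; Literature never imports `Summits`), generic-group lower bounds
  (Shoup 1997), index-calculus heuristics, and the finite-field language `DLOGHalf`.
-/

namespace Literature.Computability.Cryptography

open _root_.Computability

/-! ### Instances and the membership condition -/

/-- `ecdlpCurve p a₁ a₂ a₃ a₄ a₆`: the Weierstrass curve
`y² + a₁xy + a₃y = x³ + a₂x² + a₄x + a₆` over `ZMod p` whose coefficients are the naturals
`a₁, a₂, a₃, a₄, a₆` cast into `ZMod p` (a general Weierstrass model over the prime field when
`p` is prime; Miller uses the short form `y² = x³ + Ax + B`, the route asks for all five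
coefficients so that `p = 2, 3` need no special case). [Silverman, AEC, §III.1 (Weierstrass
equations)] [cite: SilvermanAEC2009, §III.1] -/
def ecdlpCurve (p a₁ a₂ a₃ a₄ a₆ : ℕ) : WeierstrassCurve (ZMod p) :=
  ⟨(a₁ : ZMod p), (a₂ : ZMod p), (a₃ : ZMod p), (a₄ : ZMod p), (a₆ : ZMod p)⟩

/-- `EcdlpSolvable p a₁ a₂ a₃ a₄ a₆ xp yp xq yq t`: the 11-tuple of naturals is a YES-instance of
the bounded elliptic-curve discrete-logarithm problem over the prime field `𝔽_p`: `p` is prime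
and — with `Fact p.Prime` supplied from that witness — `P = (xp, yp)` and `Q = (xq, yq)` (cast
into `ZMod p`) are nonsingular affine points of `W = ecdlpCurve p a₁ a₂ a₃ a₄ a₆`, the
discriminant of `W` is nonzero, and `m • P = Q` in the group `W.toAffine.Point` for some natural
`m ≤ t`. This is "ECDLP: find `m` with `[m]P = Q` for `P, Q ∈ E(𝔽_p)`" (Silverman, AEC,
Ex. XI.4.1(c); Miller 1986, pp. 421–423) in decision form with the bound `t` on the logarithm.
[cite: SilvermanAEC2009, Example XI.4.1(c)] -/
def EcdlpSolvable (p a₁ a₂ a₃ a₄ a₆ xp yp xq yq t : ℕ) : Prop :=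
  ∃ hp : p.Prime, (haveI : Fact p.Prime := ⟨hp⟩;
    ∃ (hP : (ecdlpCurve p a₁ a₂ a₃ a₄ a₆).toAffine.Nonsingular (xp : ZMod p) (yp : ZMod p))
      (hQ : (ecdlpCurve p a₁ a₂ a₃ a₄ a₆).toAffine.Nonsingular (xq : ZMod p) (yq : ZMod p)),
      (ecdlpCurve p a₁ a₂ a₃ a₄ a₆).Δ ≠ 0 ∧ ∃ m : ℕ, m ≤ t ∧
        m • WeierstrassCurve.Affine.Point.some (xp : ZMod p) (yp : ZMod p) hP =
          WeierstrassCurve.Affine.Point.some (xq : ZMod p) (yq : ZMod p) hQ)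

/-- `ecdlpSet`: the set of lists of naturals of the exact shape
`[p, a₁, a₂, a₃, a₄, a₆, xp, yp, xq, yq, t]` that are YES-instances of bounded prime-field
ECDLP (`EcdlpSolvable`); lists of any other length are not instances. [Silverman, AEC,
Ex. XI.4.1(c); Cook 2006, §1 (problems as sets of finite objects, then strings)]
[cite: CookClay2006, §1] -/
def ecdlpSet : Set (List ℕ) :=
  {l | ∃ p a₁ a₂ a₃ a₄ a₆ xp yp xq yq t : ℕ,
    l = [p, a₁, a₂, a₃, a₄, a₆, xp, yp, xq, yq, t] ∧ EcdlpSolvable p a₁ a₂ a₃ a₄ a₆ xp yp xq yq t}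

/-! ### The language -/

/-- **`EcdlpLanguage`** — the prime-field elliptic-curve (bounded) discrete-logarithm language
over `{0,1}`: the binary encodings `encodingListNatBool.encode [p, a₁, a₂, a₃, a₄, a₆, x_P, y_P,
x_Q, y_Q, t]` of the tuples with `p` prime, `W = ⟨a₁, a₂, a₃, a₄, a₆⟩` a Weierstrass curve over
`ZMod p` (naturals cast into `ZMod p`) with `Δ ≠ 0`, `P = (x_P, y_P)` and `Q = (x_Q, y_Q)`
nonsingular affine points of `W`, and `m • P = Q` for some `m ≤ t` (Mathlib's group law on
`WeierstrassCurve.Affine.Point`). Miller (1985) proposed the discrete logarithm problem in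
`E(𝔽_p)` — given `P` and `Q = [m]P`, find `m` — as a cryptographic primitive and argued that
index calculus should not transfer to it; this is its decision version as a language in Cook's
sense, equivalent to the search problem by binary search on `t`. The body is verbatim the
inline term of the route items `EcdlpNotInP` / `EcdlpInNP` (route PneNP/EcdlpDefinability), and
`EcdlpLanguage = encodingListNatBool.toLanguage ecdlpSet` holds by `rfl` (`EcdlpLanguage_eq`).
[Miller 1986, pp. 421–423; Silverman, AEC, Ex. XI.4.1(c); Cook 2006, §1]
[cite: Miller1986ECC, pp. 421–423] -/
def EcdlpLanguage : Language Bool :=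
  Literature.Computability.Complexity.encodingListNatBool.toLanguage {l : List ℕ |
    ∃ (p a₁ a₂ a₃ a₄ a₆ xp yp xq yq t : ℕ), l = [p, a₁, a₂, a₃, a₄, a₆, xp, yp, xq, yq, t] ∧
      ∃ hp : p.Prime, (haveI : Fact p.Prime := ⟨hp⟩;
        ∃ (hP : (⟨(a₁ : ZMod p), (a₂ : ZMod p), (a₃ : ZMod p), (a₄ : ZMod p), (a₆ : ZMod p)⟩ :
              WeierstrassCurve (ZMod p)).toAffine.Nonsingular (xp : ZMod p) (yp : ZMod p))
          (hQ : (⟨(a₁ : ZMod p), (a₂ : ZMod p), (a₃ : ZMod p), (a₄ : ZMod p), (a₆ : ZMod p)⟩ :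
              WeierstrassCurve (ZMod p)).toAffine.Nonsingular (xq : ZMod p) (yq : ZMod p)),
          (⟨(a₁ : ZMod p), (a₂ : ZMod p), (a₃ : ZMod p), (a₄ : ZMod p), (a₆ : ZMod p)⟩ :
              WeierstrassCurve (ZMod p)).Δ ≠ 0 ∧
            ∃ m : ℕ, m ≤ t ∧
              m • WeierstrassCurve.Affine.Point.some (xp : ZMod p) (yp : ZMod p) hP =
                WeierstrassCurve.Affine.Point.some (xq : ZMod p) (yq : ZMod p) hQ)}

/-! ### API -/

/-- `EcdlpLanguage` is the encoded language of `ecdlpSet` — a definitional unfolding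
(`ecdlpCurve`, `EcdlpSolvable`, `ecdlpSet` are transparent abbreviations of the verbatim route
term). [folklore] -/
theorem EcdlpLanguage_eq :
    EcdlpLanguage = Literature.Computability.Complexity.encodingListNatBool.toLanguage ecdlpSet :=
  rfl

/-- Membership of an 11-list in `ecdlpSet`, unfolded. [folklore] -/
@[simp] theorem mem_ecdlpSet_iff (p a₁ a₂ a₃ a₄ a₆ xp yp xq yq t : ℕ) :
    [p, a₁, a₂, a₃, a₄, a₆, xp, yp, xq, yq, t] ∈ ecdlpSet ↔
      EcdlpSolvable p a₁ a₂ a₃ a₄ a₆ xp yp xq yq t := by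
  refine ⟨?_, fun h => ⟨p, a₁, a₂, a₃, a₄, a₆, xp, yp, xq, yq, t, rfl, h⟩⟩
  rintro ⟨p', a₁', a₂', a₃', a₄', a₆', xp', yp', xq', yq', t', hl, h⟩
  simp only [List.cons.injEq] at hl
  obtain ⟨rfl, rfl, rfl, rfl, rfl, rfl, rfl, rfl, rfl, rfl, rfl, -⟩ := hl
  exact h

/-- Membership of an encoded 11-tuple in `EcdlpLanguage` is the YES-instance condition
`EcdlpSolvable` (the list encoding is injective, `Computability.Encoding.mem_toLanguage_iff`).
[folklore] -/
theorem encode_mem_EcdlpLanguage_iff (p a₁ a₂ a₃ a₄ a₆ xp yp xq yq t : ℕ) :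
    Literature.Computability.Complexity.encodingListNatBool.encode
        [p, a₁, a₂, a₃, a₄, a₆, xp, yp, xq, yq, t] ∈ EcdlpLanguage ↔
      EcdlpSolvable p a₁ a₂ a₃ a₄ a₆ xp yp xq yq t := by
  rw [EcdlpLanguage_eq, Encoding.mem_toLanguage_iff, mem_ecdlpSet_iff]

/-- A binary string lies in `EcdlpLanguage` iff it is the encoding of a YES-instance
`[p, a₁, a₂, a₃, a₄, a₆, xp, yp, xq, yq, t]`; in particular strings that encode no list of
naturals, or a list of another length, are rejected. [folklore] -/
theorem mem_EcdlpLanguage_iff (w : List Bool) :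
    w ∈ EcdlpLanguage ↔ ∃ p a₁ a₂ a₃ a₄ a₆ xp yp xq yq t : ℕ,
      w = Literature.Computability.Complexity.encodingListNatBool.encode
            [p, a₁, a₂, a₃, a₄, a₆, xp, yp, xq, yq, t] ∧
        EcdlpSolvable p a₁ a₂ a₃ a₄ a₆ xp yp xq yq t := by
  rw [EcdlpLanguage_eq]
  constructor
  · rintro ⟨l, ⟨p, a₁, a₂, a₃, a₄, a₆, xp, yp, xq, yq, t, rfl, h⟩, rfl⟩
    exact ⟨p, a₁, a₂, a₃, a₄, a₆, xp, yp, xq, yq, t, rfl, h⟩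
  · rintro ⟨p, a₁, a₂, a₃, a₄, a₆, xp, yp, xq, yq, t, rfl, h⟩
    exact ⟨_, (mem_ecdlpSet_iff p a₁ a₂ a₃ a₄ a₆ xp yp xq yq t).mpr h, rfl⟩

namespace EcdlpSolvable

variable {p a₁ a₂ a₃ a₄ a₆ xp yp xq yq t : ℕ}

/-- The modulus of a YES-instance is prime. [folklore] -/
theorem prime (h : EcdlpSolvable p a₁ a₂ a₃ a₄ a₆ xp yp xq yq t) : p.Prime :=
  h.1

/-- The curve of a YES-instance is an elliptic curve in Mathlib's sense: over the field
`ZMod p` the condition `Δ ≠ 0` is `IsUnit Δ`, i.e. `WeierstrassCurve.IsElliptic`.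
[Silverman, AEC, §III.1, Prop. 1.4 (nonsingular iff `Δ ≠ 0`)]
[cite: SilvermanAEC2009, Proposition III.1.4] -/
theorem isElliptic (h : EcdlpSolvable p a₁ a₂ a₃ a₄ a₆ xp yp xq yq t) :
    (ecdlpCurve p a₁ a₂ a₃ a₄ a₆).IsElliptic := by
  obtain ⟨hp, _, _, hΔ, _⟩ := h
  haveI : Fact p.Prime := ⟨hp⟩
  exact ⟨isUnit_iff_ne_zero.mpr hΔ⟩

/-- Monotonicity in the bound: a logarithm `≤ t` is a logarithm `≤ t'` whenever `t ≤ t'` (the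
direction used by binary search in the search-to-decision equivalence). [folklore] -/
theorem mono (h : EcdlpSolvable p a₁ a₂ a₃ a₄ a₆ xp yp xq yq t) {t' : ℕ} (ht : t ≤ t') :
    EcdlpSolvable p a₁ a₂ a₃ a₄ a₆ xp yp xq yq t' := by
  obtain ⟨hp, hP, hQ, hΔ, m, hm, hmPQ⟩ := h
  exact ⟨hp, hP, hQ, hΔ, m, hm.trans ht, hmPQ⟩

end EcdlpSolvable

end Literature.Computability.Cryptography
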